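import Summits.MatrixMultiplication.MatrixMultiplication.Theorems.ThinPackings.Negative.ThinPackingsPacking
import Summits.MatrixMultiplication.MatrixMultiplication.Theses.GroupTheoreticSTPP

/-!
# `¬ ThinPackings ↔ ¬ X_C`: the thin-block crux is the abelian-STPP `ω = 2` target in costume
(crux stmt-MatrixMultiplication-10595 of route ThinBlockAlpha vs target stmt-MatrixMultiplication-0593
of route GroupTheoreticSTPP)

The crux `ThinPackings` asks, for every `a < 1` and `η > 0`, for an STPP family of blocks
`⟨N, M, N⟩` with `N ≥ 2`, `M ≥ N^a` and `|H| ≤ L·N^{2+η}`.  Since only the LOWER bound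
`N^a ≤ M` is imposed, SQUARE blocks `M = N` qualify for every `a`; conversely the
`S₃`-symmetrised cube of a thin family (blocks `Aᵢ × Bⱼ × C_k` etc. in `H³`, `L³` blocks of
side `N²M ≥ N^{2+a}`) is a square family of slack `(2 − 2a + 3η)/(2 + a) → 0`.  Hence

  `ThinPackings ↔ (∀ ε > 0, a square STPP family of side n ≥ 2 with |H| ≤ L·n^{2+ε}) ↔ CThesis`,

the last step being BCCGNSU 2017 §3.2 run forwards (tensor power, words grouped by type, the
symmetrised uniform square sub-family of the best type).  All statements below are NEGATIVE forms
(refuter's lane): refuting the crux is exactly refuting `X_C` (the abelian-STPP barrier in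
unbounded exponent), and every `X_C` construction is already a crux witness family.
References: BCCGNSU 2017 (arXiv:1605.06702) Lemma 3.5, §3.2; CKSU 2005 (arXiv:math/0511460) §5.
-/

namespace Summit.MatrixMultiplication.MatrixMultiplication.Theorems.ThinPackings.Negative

open Literature.Computability.AlgebraicComplexity Finset
open Literature.Computability.AlgebraicComplexity.Combinatorics (wordType prod_eq_prod_pow_wordType
  le_of_pow_le_poly_mul_pow)
open Literature.Combinatorics.Additive (AddSimultaneousTPP)
open Summit.MatrixMultiplication.MatrixMultiplication.Theses.ThinBlockAlpha (ThinPackings)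
open Summit.MatrixMultiplication.MatrixMultiplication.Theses.GroupTheoreticSTPP (CThesis)

/-! ### Square near-tight packings give thin packings (`M = N` is allowed by `N^a ≤ M`) -/

/-- `¬ ThinPackings ⟹` no square near-tight abelian STPP packings: a square family of side
`n ≥ 2` with `|H| ≤ L·n^{2+η}` is a crux witness at EVERY `a ≤ 1` (take `M = N = n`;
`n^a ≤ n`).  [new, elementary] -/
theorem not_square_of_not_thinPackings (h : ¬ ThinPackings) :
    ¬ ∀ ε : ℝ, 0 < ε → ∃ (H : Type) (_ : AddCommGroup H) (_ : Fintype H) (L n : ℕ)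
      (A B C : Fin L → Finset H), IsSTPP A B C ∧
      (∀ i, (A i).card = n ∧ (B i).card = n ∧ (C i).card = n) ∧ 2 ≤ n ∧
      (Fintype.card H : ℝ) ≤ L * (n : ℝ) ^ (2 + ε) := by
  intro hsq
  apply h
  intro a _ ha1 η hη
  obtain ⟨H, i1, i2, L, n, A, B, C, hS, hc, hn, hH⟩ := hsq η hη
  refine ⟨H, i1, i2, L, n, n, A, B, C, hS, hc, hn, ?_, hH⟩
  have hn1 : (1 : ℝ) ≤ n := by exact_mod_cast (by omega : 1 ≤ n)
  calc (n : ℝ) ^ a ≤ (n : ℝ) ^ (1 : ℝ) := Real.rpow_le_rpow_of_exponent_le hn1 ha1.le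
    _ = n := Real.rpow_one _

/-! ### Thin packings give square near-tight packings (symmetrised cube) -/

/-- No square near-tight packings `⟹ ¬ ThinPackings`: the `S₃`-symmetrised cube of a thin
family at `a = 1 − ε'/4`, `η = ε'/6` (`ε' = min ε 1`) — blocks
`(Aᵢ × Bⱼ × C_k, Bᵢ × Cⱼ × A_k, Cᵢ × Aⱼ × B_k)` in `H³`, an STPP family by
`AddSimultaneousTPP.prod/rotate` — has `L³` square blocks of side `N²M ≥ N^{2+a}` and
`|H|³ ≤ L³ N^{6+3η} ≤ L³ (N²M)^{2+ε}`.  [new; BCCGNSU 2017 Lemma 3.5 symmetrisation] -/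
theorem not_thinPackings_of_not_square
    (h : ¬ ∀ ε : ℝ, 0 < ε → ∃ (H : Type) (_ : AddCommGroup H) (_ : Fintype H) (L n : ℕ)
      (A B C : Fin L → Finset H), IsSTPP A B C ∧
      (∀ i, (A i).card = n ∧ (B i).card = n ∧ (C i).card = n) ∧ 2 ≤ n ∧
      (Fintype.card H : ℝ) ≤ L * (n : ℝ) ^ (2 + ε)) :
    ¬ ThinPackings := by
  intro hT
  apply h
  intro ε hε
  set ε' : ℝ := min ε 1 with hε'
  have hε'0 : 0 < ε' := lt_min hε one_pos
  have hε'1 : ε' ≤ 1 := min_le_right _ _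
  have hε'ε : ε' ≤ ε := min_le_left _ _
  obtain ⟨H, i1, i2, L, N, M, A, B, C, hS, hc, hN, hM, hH⟩ :=
    hT (1 - ε' / 4) (by linarith) (by linarith) (ε' / 6) (by positivity)
  classical
  have hS' := (isSTPP_iff_addSimultaneousTPP A B C).1 hS
  have hbig := hS'.prod (hS'.rotate.prod hS'.rotate.rotate)
  set e := Fintype.equivFin (Fin L × Fin L × Fin L) with he
  have hSτ := hbig.comp e.symm.injective
  have hM1 : 1 ≤ M := one_le_M hN (by linarith) hM
  have hL := one_le_L hH
  refine ⟨H × H × H, inferInstance, inferInstance, Fintype.card (Fin L × Fin L × Fin L), N * M * N,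
    fun x => A (e.symm x).1 ×ˢ (B (e.symm x).2.1 ×ˢ C (e.symm x).2.2),
    fun x => B (e.symm x).1 ×ˢ (C (e.symm x).2.1 ×ˢ A (e.symm x).2.2),
    fun x => C (e.symm x).1 ×ˢ (A (e.symm x).2.1 ×ˢ B (e.symm x).2.2), ?_, ?_, ?_, ?_⟩
  · exact (isSTPP_iff_addSimultaneousTPP _ _ _).2 hSτ
  · intro x
    simp only [card_product, (hc _).1, (hc _).2.1, (hc _).2.2]
    exact ⟨by ring, by ring, by ring⟩
  · calc 2 ≤ N := hN
      _ = N * 1 * 1 := by ring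
      _ ≤ N * M * N := by gcongr; omega
  · -- `|H|³ ≤ L³ (N M N)^{2+ε}`
    have hN1 : (1 : ℝ) < N := by exact_mod_cast (by omega : 1 < N)
    have hNpos : (0 : ℝ) < N := by linarith
    have hHpos : (0 : ℝ) ≤ Fintype.card H := Nat.cast_nonneg _
    have hvol : (N : ℝ) ^ (2 + (1 - ε' / 4)) ≤ ((N * M * N : ℕ) : ℝ) := by
      rw [Real.rpow_add hNpos, Real.rpow_two]
      push_cast
      calc (N : ℝ) ^ 2 * (N : ℝ) ^ (1 - ε' / 4) ≤ (N : ℝ) ^ 2 * (M : ℝ) := by gcongr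
        _ = (N : ℝ) * M * N := by ring
    have hexp : 3 * (2 + ε' / 6) ≤ (2 + (1 - ε' / 4)) * (2 + ε) := by
      nlinarith [mul_nonneg hε'0.le hε.le]
    have hcardH : (Fintype.card (H × H × H) : ℝ) = (Fintype.card H : ℝ) ^ 3 := by
      rw [Fintype.card_prod, Fintype.card_prod]; push_cast; ring
    have hcardL : (Fintype.card (Fin L × Fin L × Fin L) : ℝ) = (L : ℝ) ^ 3 := by
      rw [Fintype.card_prod, Fintype.card_prod, Fintype.card_fin]; push_cast; ring
    rw [hcardH, hcardL]
    calc (Fintype.card H : ℝ) ^ 3 ≤ ((L : ℝ) * (N : ℝ) ^ (2 + ε' / 6)) ^ 3 :=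
          pow_le_pow_left₀ hHpos hH 3
      _ = (L : ℝ) ^ 3 * (N : ℝ) ^ (3 * (2 + ε' / 6)) := by
          rw [mul_pow, ← Real.rpow_natCast ((N : ℝ) ^ (2 + ε' / 6)) 3, ← Real.rpow_mul hNpos.le]
          congr 1; congr 1; push_cast; ring
      _ ≤ (L : ℝ) ^ 3 * (N : ℝ) ^ ((2 + (1 - ε' / 4)) * (2 + ε)) :=
          mul_le_mul_of_nonneg_left (Real.rpow_le_rpow_of_exponent_le hN1.le hexp)
            (by positivity)
      _ = (L : ℝ) ^ 3 * ((N : ℝ) ^ (2 + (1 - ε' / 4))) ^ (2 + ε) := by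
          rw [Real.rpow_mul hNpos.le]
      _ ≤ (L : ℝ) ^ 3 * ((N * M * N : ℕ) : ℝ) ^ (2 + ε) := by
          gcongr

/-! ### Square near-tight packings and `X_C` -/

/-- `¬ X_C ⟹` no square near-tight packings: a square family of slack `ε/2` has
`Σᵢ (n³)^{(2+ε)/3} = L·n^{2+ε} > L·n^{2+ε/2} ≥ |H|`. [new, elementary] -/
theorem not_square_of_not_cThesis (h : ¬ CThesis) :
    ¬ ∀ ε : ℝ, 0 < ε → ∃ (H : Type) (_ : AddCommGroup H) (_ : Fintype H) (L n : ℕ)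
      (A B C : Fin L → Finset H), IsSTPP A B C ∧
      (∀ i, (A i).card = n ∧ (B i).card = n ∧ (C i).card = n) ∧ 2 ≤ n ∧
      (Fintype.card H : ℝ) ≤ L * (n : ℝ) ^ (2 + ε) := by
  intro hsq
  apply h
  intro ε hε
  obtain ⟨H, i1, i2, L, n, A, B, C, hS, hc, hn, hH⟩ := hsq (ε / 2) (by positivity)
  refine ⟨H, i1, i2, L, A, B, C, hS, ?_⟩
  have hL := one_le_L hH
  have hLpos : (0 : ℝ) < L := by exact_mod_cast (by omega : 0 < L)
  have hn1 : (1 : ℝ) < n := by exact_mod_cast (by omega : 1 < n)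
  have hnpos : (0 : ℝ) < n := by linarith
  have hsum : ∑ i : Fin L, (((A i).card * (B i).card * (C i).card : ℕ) : ℝ) ^ ((2 + ε) / 3) =
      L * ((n : ℝ) ^ (2 + ε)) := by
    rw [Finset.sum_congr rfl fun i _ => by rw [(hc i).1, (hc i).2.1, (hc i).2.2], sum_const,
      card_univ, Fintype.card_fin, nsmul_eq_mul]
    congr 1
    push_cast
    rw [show (n : ℝ) * n * n = (n : ℝ) ^ (3 : ℕ) by ring, ← Real.rpow_natCast,
      ← Real.rpow_mul hnpos.le]
    congr 1; push_cast; ring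
  rw [hsum]
  calc (Fintype.card H : ℝ) ≤ L * (n : ℝ) ^ (2 + ε / 2) := hH
    _ < L * (n : ℝ) ^ (2 + ε) := by
        gcongr
        exact Real.rpow_lt_rpow_of_exponent_lt hn1 (by linarith)

section

variable {H : Type*} [AddCommGroup H] {L : ℕ} {A B C : Fin L → Finset H}

/-- Two-leg packing over a sub-family: `Σ_{i∈S} |Aᵢ||Cᵢ| ≤ |H|` if `Bᵢ ≠ ∅` on `S`.
[folklore; BCCGNSU 2017 §2] -/
theorem sum_card_AC_le_of_nonempty_on [Fintype H] (hS : IsSTPP A B C) (S : Finset (Fin L))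
    (hB : ∀ i ∈ S, (B i).Nonempty) : ∑ i ∈ S, (A i).card * (C i).card ≤ Fintype.card H := by
  classical
  have hinj : Set.InjOn (fun x : (Σ _ : Fin L, H × H) => x.2.1 - x.2.2)
      ↑(S.sigma fun k => A k ×ˢ C k) := by
    rintro ⟨k, s, u'⟩ hx ⟨k₂, s₂, u₂⟩ hy he
    rw [mem_coe, mem_sigma, mem_product] at hx hy
    change s - u' = s₂ - u₂ at he
    obtain ⟨b, hb⟩ := hB k₂ hy.1
    have h0 : (s₂ - s) + (b - b) + (u' - u₂) = 0 := by
      have : (s₂ - s) + (b - b) + (u' - u₂) = (s₂ - u₂) - (s - u') := by abel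
      rw [this, he, sub_self]
    obtain ⟨-, h2, h3, -, h5⟩ := hS k₂ k₂ k s hx.2.1 s₂ hy.2.1 b hb b hb u₂ hy.2.2 u' hx.2.2 h0
    subst h2 h3 h5
    rfl
  calc ∑ k ∈ S, (A k).card * (C k).card = (S.sigma fun k => A k ×ˢ C k).card := by
        rw [card_sigma]; simp only [card_product]
    _ = ((S.sigma fun k => A k ×ˢ C k).image
          fun x : (Σ _ : Fin L, H × H) => x.2.1 - x.2.2).card :=
        (card_image_of_injOn hinj).symm
    _ ≤ Fintype.card H := card_le_univ _

end

/-- No square near-tight packings `⟹ ¬ X_C` — BCCGNSU 2017 §3.2 run forwards.  Given an STPP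
family with `F = Σᵢ mᵢ^β > |H|` (`β = (2+ε)/3`, `mᵢ = |Aᵢ||Bᵢ||Cᵢ|`): volume-one blocks are at
most `|H|` in number (two-leg packing), `F^N = Σ_τ T_τ P_τ^β` over word types `τ` (`P_τ = ∏ mᵢ^{τᵢ}`,
at most `(N+1)^{L₀}` types), so for `N` large some type with `P_τ ≥ 2` has `T_τ P_τ^β ≥ |H|^N`;
the symmetrised sub-family of that type in `(H^N)³` has `T_τ³` square blocks of side `P_τ` and
`|H|^{3N} ≤ T_τ³ P_τ^{3β} = T_τ³ P_τ^{2+ε}`.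
[new; cite: BlasiakChurchCohnGrochowNaslundSawinUmans2017, Lemma 3.5, §3.2] -/
theorem not_cThesis_of_not_square
    (h : ¬ ∀ ε : ℝ, 0 < ε → ∃ (H : Type) (_ : AddCommGroup H) (_ : Fintype H) (L n : ℕ)
      (A B C : Fin L → Finset H), IsSTPP A B C ∧
      (∀ i, (A i).card = n ∧ (B i).card = n ∧ (C i).card = n) ∧ 2 ≤ n ∧
      (Fintype.card H : ℝ) ≤ L * (n : ℝ) ^ (2 + ε)) :
    ¬ CThesis := by
  intro hC
  apply h
  intro ε hε
  obtain ⟨H, i1, i2, L₀, A, B, C, hS0, hlt⟩ := hC ε hε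
  classical
  have hS : IsSTPP A B C := hS0
  have hS' := (isSTPP_iff_addSimultaneousTPP A B C).1 hS
  set β : ℝ := (2 + ε) / 3 with hβ
  have hβpos : 0 < β := by positivity
  set m : Fin L₀ → ℕ := fun i => (A i).card * (B i).card * (C i).card with hm
  set F : ℝ := ∑ i, ((m i : ℕ) : ℝ) ^ β with hF
  have hHpos : (0 : ℝ) < Fintype.card H := by exact_mod_cast Fintype.card_pos
  have hlt' : (Fintype.card H : ℝ) < F := hlt
  -- volume-one blocks are few
  set S₁ : Finset (Fin L₀) := univ.filter fun i => m i = 1 with hS₁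
  have hL₁ : S₁.card ≤ Fintype.card H := by
    have hone : ∀ i ∈ S₁, (A i).card = 1 ∧ (B i).card = 1 ∧ (C i).card = 1 := by
      intro i hi
      have h1 : (A i).card * (B i).card * (C i).card = 1 := (mem_filter.1 hi).2
      exact ⟨Nat.eq_one_of_mul_eq_one_right (Nat.eq_one_of_mul_eq_one_right h1),
        Nat.eq_one_of_mul_eq_one_left (Nat.eq_one_of_mul_eq_one_right h1),
        Nat.eq_one_of_mul_eq_one_left h1⟩
    have h2 := sum_card_AC_le_of_nonempty_on hS S₁ fun i hi =>
      card_pos.1 (by rw [(hone i hi).2.1]; exact one_pos)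
    rw [Finset.sum_congr rfl fun i hi => by rw [(hone i hi).1, (hone i hi).2.2], sum_const,
      smul_eq_mul] at h2
    simpa only [mul_one] using h2
  -- the tensor power
  obtain ⟨N, -, hNbig⟩ : ∃ N : ℕ, 1 ≤ N ∧
      ¬ F ^ N ≤ 2 * ((N : ℝ) + 1) ^ L₀ * (Fintype.card H : ℝ) ^ N := by
    by_contra hcon
    push Not at hcon
    have := le_of_pow_le_poly_mul_pow (x := F) (c := 2) (d := L₀) hHpos fun N hN => (hcon N hN)
    linarith
  push Not at hNbig
  -- expansion of `F^N` over words, grouped by value of the type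
  have hFN : F ^ N = ∑ u : Fin N → Fin L₀, (((∏ i, m i ^ (wordType u i : ℕ) : ℕ) : ℝ)) ^ β := by
    have h1 : F ^ N = ∏ _l : Fin N, F := by rw [Finset.prod_const, card_univ, Fintype.card_fin]
    rw [h1, hF, Fintype.prod_sum (fun (_ : Fin N) (i : Fin L₀) => ((m i : ℕ) : ℝ) ^ β)]
    refine Finset.sum_congr rfl fun u _ => ?_
    rw [Real.finsetProd_rpow _ _ (fun l _ => by positivity), ← prod_eq_prod_pow_wordType m u]
    push_cast
    rfl
  set P : (Fin L₀ → Fin (N + 1)) → ℕ := fun τ => ∏ i, m i ^ (τ i : ℕ) with hP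
  have hPu : ∀ u : Fin N → Fin L₀, P (wordType u) = ∏ l, m (u l) := fun u => by
    rw [hP]; exact (prod_eq_prod_pow_wordType m u).symm
  set fib : (Fin L₀ → Fin (N + 1)) → Finset (Fin N → Fin L₀) :=
    fun τ => univ.filter fun u => wordType u = τ with hfib
  -- bad words contribute at most `L₁^N ≤ |H|^N`
  have hbad : ∑ u ∈ univ.filter (fun u : Fin N → Fin L₀ => ¬ 2 ≤ P (wordType u)),
      (((P (wordType u)) : ℕ) : ℝ) ^ β ≤ (Fintype.card H : ℝ) ^ N := by
    calc ∑ u ∈ univ.filter (fun u : Fin N → Fin L₀ => ¬ 2 ≤ P (wordType u)),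
          (((P (wordType u)) : ℕ) : ℝ) ^ β
        ≤ ∑ u ∈ univ.filter (fun u : Fin N → Fin L₀ => ¬ 2 ≤ P (wordType u)),
            (if u ∈ Fintype.piFinset (fun _ : Fin N => S₁) then (1 : ℝ) else 0) := by
          refine Finset.sum_le_sum fun u hu => ?_
          have hu2 : P (wordType u) ≤ 1 := by have := (mem_filter.1 hu).2; omega
          rcases Nat.le_one_iff_eq_zero_or_eq_one.1 hu2 with h0 | h1
          · rw [h0, Nat.cast_zero, Real.zero_rpow hβpos.ne']
            split_ifs <;> norm_num
          · have hu1 : u ∈ Fintype.piFinset (fun _ : Fin N => S₁) := by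
              rw [Fintype.mem_piFinset]
              intro l
              rw [hS₁, mem_filter]
              refine ⟨mem_univ _, ?_⟩
              have hprod : ∏ l, m (u l) = 1 := by rw [← hPu u]; exact h1
              exact Nat.dvd_one.1 (hprod ▸ Finset.dvd_prod_of_mem (fun l => m (u l)) (mem_univ l))
            rw [h1, if_pos hu1]; simp
      _ ≤ ∑ u ∈ (univ : Finset (Fin N → Fin L₀)),
            (if u ∈ Fintype.piFinset (fun _ : Fin N => S₁) then (1 : ℝ) else 0) :=
          Finset.sum_le_sum_of_subset_of_nonneg (filter_subset _ _)
            (fun u _ _ => by split_ifs <;> norm_num)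
      _ = ((Fintype.piFinset fun _ : Fin N => S₁).card : ℝ) := by
          rw [Finset.sum_ite_mem, univ_inter, sum_const, nsmul_eq_mul, mul_one]
      _ = (S₁.card : ℝ) ^ N := by rw [Fintype.card_piFinset_const]; push_cast; ring
      _ ≤ (Fintype.card H : ℝ) ^ N := pow_le_pow_left₀ (Nat.cast_nonneg _) (by exact_mod_cast hL₁) N
  -- good words, grouped by type
  set Tg : Finset (Fin L₀ → Fin (N + 1)) := univ.filter fun τ => 2 ≤ P τ with hTg
  have hgood : ∑ u ∈ univ.filter (fun u : Fin N → Fin L₀ => 2 ≤ P (wordType u)),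
      (((P (wordType u)) : ℕ) : ℝ) ^ β = ∑ τ ∈ Tg, ((fib τ).card : ℝ) * ((P τ : ℕ) : ℝ) ^ β := by
    rw [← Finset.sum_fiberwise_of_maps_to (s := univ.filter fun u => 2 ≤ P (wordType u))
      (t := Tg) (g := wordType)
      (fun u hu => by rw [hTg, mem_filter]; exact ⟨mem_univ _, (mem_filter.1 hu).2⟩)]
    refine Finset.sum_congr rfl fun τ hτ => ?_
    have hτ2 : 2 ≤ P τ := (mem_filter.1 hτ).2
    have hfil : (univ.filter fun u : Fin N → Fin L₀ => 2 ≤ P (wordType u)).filter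
        (fun u => wordType u = τ) = fib τ := by
      ext u
      simp only [hfib, mem_filter, mem_univ, true_and]
      constructor
      · exact fun h => h.2
      · intro h; exact ⟨h ▸ hτ2, h⟩
    rw [hfil, Finset.sum_congr rfl fun u hu => (show ((P (wordType u) : ℕ) : ℝ) ^ β =
      ((P τ : ℕ) : ℝ) ^ β by rw [(mem_filter.1 hu).2]), sum_const, nsmul_eq_mul]
  have hsplit : F ^ N =
      (∑ u ∈ univ.filter (fun u : Fin N → Fin L₀ => 2 ≤ P (wordType u)),
        (((P (wordType u)) : ℕ) : ℝ) ^ β) +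
      ∑ u ∈ univ.filter (fun u : Fin N → Fin L₀ => ¬ 2 ≤ P (wordType u)),
        (((P (wordType u)) : ℕ) : ℝ) ^ β := by
    rw [hFN, Finset.sum_filter_add_sum_filter_not]
  have hgood_ge : 2 * ((N : ℝ) + 1) ^ L₀ * (Fintype.card H : ℝ) ^ N - (Fintype.card H : ℝ) ^ N <
      ∑ τ ∈ Tg, ((fib τ).card : ℝ) * ((P τ : ℕ) : ℝ) ^ β := by
    rw [← hgood]; linarith
  have hX1 : (1 : ℝ) ≤ ((N : ℝ) + 1) ^ L₀ := one_le_pow₀ (by linarith [(Nat.cast_nonneg N : (0 : ℝ) ≤ N)])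
  have hhN : (0 : ℝ) < (Fintype.card H : ℝ) ^ N := pow_pos hHpos N
  have hTgcard : (Tg.card : ℝ) ≤ ((N : ℝ) + 1) ^ L₀ := by
    have h1 : Tg.card ≤ (univ : Finset (Fin L₀ → Fin (N + 1))).card := card_le_univ _
    rw [card_univ, Fintype.card_fun, Fintype.card_fin, Fintype.card_fin] at h1
    exact_mod_cast h1
  have hTgne : Tg.Nonempty := by
    by_contra h0
    rw [not_nonempty_iff_eq_empty] at h0
    rw [h0, sum_empty] at hgood_ge
    nlinarith
  -- pigeonhole over good types
  obtain ⟨τ, hτ, hτbig⟩ : ∃ τ ∈ Tg,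
      (Fintype.card H : ℝ) ^ N ≤ ((fib τ).card : ℝ) * ((P τ : ℕ) : ℝ) ^ β := by
    by_contra hcon
    push Not at hcon
    have hsum_lt : ∑ τ ∈ Tg, ((fib τ).card : ℝ) * ((P τ : ℕ) : ℝ) ^ β <
        ∑ _τ ∈ Tg, (Fintype.card H : ℝ) ^ N := Finset.sum_lt_sum_of_nonempty hTgne hcon
    rw [sum_const, nsmul_eq_mul] at hsum_lt
    nlinarith [mul_le_mul_of_nonneg_right hTgcard hhN.le]
  have hτ2 : 2 ≤ P τ := (mem_filter.1 hτ).2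
  -- the symmetrised square sub-family of type `τ` in `(H^N)³`
  set Tf : Finset (Fin N → Fin L₀) := fib τ with hTfdef
  have hTfmem : ∀ u : Tf, wordType u.1 = τ := fun u => (mem_filter.1 u.2).2
  set piA : (Fin N → Fin L₀) → Finset (Fin N → H) := fun u => Fintype.piFinset fun l => A (u l)
    with hpiA
  set piB : (Fin N → Fin L₀) → Finset (Fin N → H) := fun u => Fintype.piFinset fun l => B (u l)
    with hpiB
  set piC : (Fin N → Fin L₀) → Finset (Fin N → H) := fun u => Fintype.piFinset fun l => C (u l)
    with hpiC
  have hSpi : AddSimultaneousTPP (G := Fin N → H) piA piB piC := hS'.pi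
  have hbig := hSpi.prod (hSpi.rotate.prod hSpi.rotate.rotate)
  set e := Fintype.equivFin (Tf × Tf × Tf) with he
  set emb : Fin (Fintype.card (Tf × Tf × Tf)) →
      (Fin N → Fin L₀) × (Fin N → Fin L₀) × (Fin N → Fin L₀) :=
    fun x => ((e.symm x).1.1, (e.symm x).2.1.1, (e.symm x).2.2.1) with hemb
  have hinj : Function.Injective emb := by
    intro x y hxy
    simp only [hemb, Prod.mk.injEq] at hxy
    exact e.symm.injective
      (Prod.ext (Subtype.ext hxy.1) (Prod.ext (Subtype.ext hxy.2.1) (Subtype.ext hxy.2.2)))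
  have hSτ := hbig.comp hinj
  have hsA : ∀ u : Tf, (piA u.1).card = ∏ i, (A i).card ^ (τ i : ℕ) := by
    intro u; rw [hpiA]; simp only
    rw [Fintype.card_piFinset, prod_eq_prod_pow_wordType (fun i => (A i).card) u.1, hTfmem u]
  have hsB : ∀ u : Tf, (piB u.1).card = ∏ i, (B i).card ^ (τ i : ℕ) := by
    intro u; rw [hpiB]; simp only
    rw [Fintype.card_piFinset, prod_eq_prod_pow_wordType (fun i => (B i).card) u.1, hTfmem u]
  have hsC : ∀ u : Tf, (piC u.1).card = ∏ i, (C i).card ^ (τ i : ℕ) := by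
    intro u; rw [hpiC]; simp only
    rw [Fintype.card_piFinset, prod_eq_prod_pow_wordType (fun i => (C i).card) u.1, hTfmem u]
  set n : ℕ := (∏ i, (A i).card ^ (τ i : ℕ)) * (∏ i, (B i).card ^ (τ i : ℕ)) *
    (∏ i, (C i).card ^ (τ i : ℕ)) with hn
  have hn' : n = P τ := by
    rw [hn, hP]; simp only
    rw [← Finset.prod_mul_distrib, ← Finset.prod_mul_distrib]
    refine Finset.prod_congr rfl fun i _ => ?_
    rw [mul_pow, mul_pow]
  refine ⟨(Fin N → H) × (Fin N → H) × (Fin N → H), inferInstance, inferInstance,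
    Fintype.card (Tf × Tf × Tf), n,
    fun x => piA (emb x).1 ×ˢ (piB (emb x).2.1 ×ˢ piC (emb x).2.2),
    fun x => piB (emb x).1 ×ˢ (piC (emb x).2.1 ×ˢ piA (emb x).2.2),
    fun x => piC (emb x).1 ×ˢ (piA (emb x).2.1 ×ˢ piB (emb x).2.2), ?_, ?_, ?_, ?_⟩
  · exact (isSTPP_iff_addSimultaneousTPP _ _ _).2 hSτ
  · intro x
    refine ⟨?_, ?_, ?_⟩
    · show (piA (e.symm x).1.1 ×ˢ (piB (e.symm x).2.1.1 ×ˢ piC (e.symm x).2.2.1)).card = n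
      rw [card_product, card_product, hsA, hsB, hsC, hn, mul_assoc]
    · show (piB (e.symm x).1.1 ×ˢ (piC (e.symm x).2.1.1 ×ˢ piA (e.symm x).2.2.1)).card = n
      rw [card_product, card_product, hsA, hsB, hsC, hn]; ring
    · show (piC (e.symm x).1.1 ×ˢ (piA (e.symm x).2.1.1 ×ˢ piB (e.symm x).2.2.1)).card = n
      rw [card_product, card_product, hsA, hsB, hsC, hn]; ring
  · rw [hn']; exact hτ2
  · have hcardG : (Fintype.card ((Fin N → H) × (Fin N → H) × (Fin N → H)) : ℝ) =
        ((Fintype.card H : ℝ) ^ N) ^ 3 := by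
      rw [Fintype.card_prod, Fintype.card_prod, Fintype.card_fun, Fintype.card_fin]
      push_cast; ring
    have hcardT : (Fintype.card (Tf × Tf × Tf) : ℝ) = ((fib τ).card : ℝ) ^ 3 := by
      rw [Fintype.card_prod, Fintype.card_prod, Fintype.card_coe, hTfdef]; push_cast; ring
    have hP0 : (0 : ℝ) ≤ ((P τ : ℕ) : ℝ) := Nat.cast_nonneg _
    have hnpow : ((n : ℕ) : ℝ) ^ (2 + ε) = (((P τ : ℕ) : ℝ) ^ β) ^ 3 := by
      rw [hn', ← Real.rpow_natCast (((P τ : ℕ) : ℝ) ^ β) 3, ← Real.rpow_mul hP0]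
      congr 1; rw [hβ]; push_cast; ring
    rw [hcardG, hcardT, hnpow, ← mul_pow]
    exact pow_le_pow_left₀ hhN.le hτbig 3

/-! ### Assembly: the crux is `X_C` in costume -/

/-- **`¬ ThinPackings ↔ ¬ X_C`.**  Refuting the thin-block crux of route ThinBlockAlpha is
EXACTLY refuting the target `CThesis` of route GroupTheoreticSTPP (stmt-0593): an abelian-STPP
barrier in unbounded exponent.  (Positive reading, for planners: every `X_C` construction is a
crux witness with `M = N`; the thin shape and the `(a, η)` bookkeeping add and lose nothing at
the level of the full statement.) [new] -/
theorem not_thinPackings_iff_not_cThesis : ¬ ThinPackings ↔ ¬ CThesis :=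
  ⟨fun h => not_cThesis_of_not_square (not_square_of_not_thinPackings h),
   fun h => not_thinPackings_of_not_square (not_square_of_not_cThesis h)⟩

end Summit.MatrixMultiplication.MatrixMultiplication.Theorems.ThinPackings.Negative
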